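import Summits.AtomisticToContinuum.Crystallization.Theorems.ChargedEnergyGapWeightLedgerA
import HarnessLib

/-!
# «WeightLedger» (lens-3 g52 part I-B/L-C/L-D/M-A/N-A over abstract core weights W) — part B (sequel of `…ChargedEnergyGapWeightLedgerA`)

Split for the 400-line cap by the landing lane (hand-2 g30); the module docstring of part A describes the whole node.  Same namespace; all FQNs unchanged.
0 sorry; standard axioms.
-/

noncomputable section
open scoped Classical
open Literature.MathematicalPhysics.StatisticalMechanics
open Literature.Geometry.DiscreteGeometry
open Summit.AtomisticToContinuum.Crystallization.Theses.PricedLinkCensus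
open Summit.AtomisticToContinuum.Crystallization.Theorems.ChargedEnergyGapNegative

namespace Summit.AtomisticToContinuum.Crystallization.Theorems.ChargedEnergyGapChartDial

/-! ## §3 Regular ball account, near-gross sites, summed immunity, clean far account; the one-sided guard splits (parts L-D, M-A over `W`) -/

section Clean

variable {θ ε R r η L δ L' ϱ : ℝ} (W : CoreWeights θ ε R r η L δ L' ϱ) (ρ₀ : ℝ)

/-- The **CLEAN FAR ACCOUNT**: the far account restricted to CLEAN sites (neither other-gross nor near-gross). -/
def farCleanExcessW (Q : PeriodicConfiguration 3) : ℝ :=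
  ∑ y : Q.motif, if IsOtherGross θ ε R r η L δ L' Q y then 0 else
    if NearOtherGross θ ε R r η L δ L' ρ₀ Q y then 0 else W.far Q (y : E3) * (siteEnergy Q (y : E3) - eStar)

/-- The far neighbourhood debit as ONE sum over the debit pairs. -/
theorem farNearDebitW_eq_sum_debitPairs (Q : PeriodicConfiguration 3) :
    farNearDebitW W ρ₀ Q = ∑ p ∈ debitPairs θ ε R r η L δ L' ρ₀ Q, W.far Q p.2 := by
  unfold farNearDebitW debitPairs
  rw [Finset.sum_sigma]
  refine Finset.sum_congr rfl fun z _ => ?_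
  split_ifs <;> simp

/-- ★ **SUMMED IMMUNITY** (W2 + W8): the far weights of ALL near-gross motif sites together are dominated by the far neighbourhood debit. -/
theorem sum_far_nearOtherGross_le_farNearDebitW (Q : PeriodicConfiguration 3) :
    (∑ y : Q.motif, if NearOtherGross θ ε R r η L δ L' ρ₀ Q y then W.far Q (y : E3) else 0) ≤ farNearDebitW W ρ₀ Q := by
  have hex : ∀ y : Q.motif, ∃ p : Σ _ : Q.motif, E3, NearOtherGross θ ε R r η L δ L' ρ₀ Q y →
      p ∈ debitPairs θ ε R r η L δ L' ρ₀ Q ∧ ∃ g ∈ Q.lattice, p.2 = (y : E3) - g := by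
    intro y
    by_cases h : NearOtherGross θ ε R r η L δ L' ρ₀ Q y
    · obtain ⟨p, hp⟩ := exists_debitPair_of_nearOtherGross h
      exact ⟨p, fun _ => hp⟩
    · exact ⟨⟨y, (y : E3)⟩, fun h' => absurd h' h⟩
  choose F hF using hex
  set N : Finset Q.motif := Finset.univ.filter fun y : Q.motif => NearOtherGross θ ε R r η L δ L' ρ₀ Q y with hN
  have hmemN : ∀ {y : Q.motif}, y ∈ N → NearOtherGross θ ε R r η L δ L' ρ₀ Q y := fun hy => (Finset.mem_filter.1 hy).2
  have hinj : Set.InjOn F ↑N := by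
    intro y₁ hy₁ y₂ hy₂ h12
    obtain ⟨g₁, hg₁, h₁⟩ := (hF y₁ (hmemN hy₁)).2
    obtain ⟨g₂, hg₂, h₂⟩ := (hF y₂ (hmemN hy₂)).2
    have h : (y₁ : E3) - g₁ = (y₂ : E3) - g₂ := by rw [← h₁, ← h₂, h12]
    have hsub : (y₁ : E3) - (y₂ : E3) ∈ Q.lattice := by
      rw [sub_eq_sub_iff_sub_eq_sub.1 h]; exact Q.lattice.sub_mem hg₁ hg₂
    exact Subtype.ext (Q.eq_of_sub_mem _ y₁.2 _ y₂.2 hsub)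
  have hper : ∀ y ∈ N, W.far Q (y : E3) = W.far Q (F y).2 := by
    intro y hy
    obtain ⟨g, hg, h2⟩ := (hF y (hmemN hy)).2
    rw [h2, ← W.far_add_period Q g hg ((y : E3) - g), sub_add_cancel]
  have hsub : N.image F ⊆ debitPairs θ ε R r η L δ L' ρ₀ Q := by
    intro p hp
    obtain ⟨y, hy, rfl⟩ := Finset.mem_image.1 hp
    exact (hF y (hmemN hy)).1
  calc (∑ y : Q.motif, if NearOtherGross θ ε R r η L δ L' ρ₀ Q y then W.far Q (y : E3) else 0)
      = ∑ y ∈ N, W.far Q (y : E3) := by rw [hN, Finset.sum_filter]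
    _ = ∑ y ∈ N, W.far Q (F y).2 := Finset.sum_congr rfl hper
    _ = ∑ p ∈ N.image F, W.far Q p.2 := (Finset.sum_image (f := fun p : Σ _ : Q.motif, E3 => W.far Q p.2) hinj).symm
    _ ≤ ∑ p ∈ debitPairs θ ε R r η L δ L' ρ₀ Q, W.far Q p.2 :=
        Finset.sum_le_sum_of_subset_of_nonneg hsub fun p _ _ => W.far_nonneg Q p.2
    _ = farNearDebitW W ρ₀ Q := (farNearDebitW_eq_sum_debitPairs W ρ₀ Q).symm

/-- Cores carry no term of the clean far account (W5): it is carried by the CLEAN PLAIN sites. -/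
theorem farCleanExcessW_eq_sum_clean_plain (Q : PeriodicConfiguration 3) :
    farCleanExcessW W ρ₀ Q = ∑ y : Q.motif,
      if IsOtherGross θ ε R r η L δ L' Q y ∨ IsCore θ ε R r η L δ L' Q y ∨ NearOtherGross θ ε R r η L δ L' ρ₀ Q y then 0 else
        W.far Q (y : E3) * (siteEnergy Q (y : E3) - eStar) := by
  unfold farCleanExcessW
  refine Finset.sum_congr rfl fun y _ => ?_
  by_cases hg : IsOtherGross θ ε R r η L δ L' Q y
  · simp [hg]
  · by_cases hc : IsCore θ ε R r η L δ L' Q y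
    · simp [hg, hc, W.far_of_isCore Q y hc]
    · by_cases hn : NearOtherGross θ ε R r η L δ L' ρ₀ Q y <;> simp [hg, hc, hn]

variable {ρ₀} {s : ℝ}

/-- ★ ONE-SIDED GUARD SPLIT (ball; W1, site floor of part L-D): under the guard the regular ball account exceeds the ball account by at
most `sepFloor s ·` the neighbourhood debit (`0 < s`, `0 ≤ ρ₀`). -/
theorem ballRegularExcessW_sub_le_ballExcessW {Q : PeriodicConfiguration 3} (hG : Guard ε s Q) (hs : 0 < s) (hρ : 0 ≤ ρ₀) (x : Q.motif) :
    ballRegularExcessW W Q x - sepFloor s * ballNearDebitW W ρ₀ Q x ≤ ballExcessW W Q x := by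
  have h1 : sepFloor s * (∑ y : Q.motif, if IsOtherGross θ ε R r η L δ L' Q y then W.ball Q x (y : E3) else 0) ≤
      sepFloor s * ballNearDebitW W ρ₀ Q x :=
    mul_le_mul_of_nonneg_left (sum_ball_otherGross_le_ballNearDebitW W hρ Q x) (sepFloor_nonneg hs)
  have h2 : ballRegularExcessW W Q x - sepFloor s * (∑ y : Q.motif, if IsOtherGross θ ε R r η L δ L' Q y then W.ball Q x (y : E3) else 0)
      ≤ ballExcessW W Q x := by
    rw [ballRegularExcessW, ballExcessW, Finset.mul_sum, ← Finset.sum_sub_distrib]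
    refine Finset.sum_le_sum fun y _ => ?_
    have hw := W.ball_nonneg Q x (y : E3)
    have he := neg_sepFloor_le_siteExcess_of_guard hG hs y
    split_ifs <;> nlinarith [mul_le_mul_of_nonneg_left he hw]
  linarith

/-- ★ ONE-SIDED GUARD SPLIT (far; W2 + W8, site floor, summed immunity): under the guard the clean far account exceeds the far account
by at most `sepFloor s ·` the far neighbourhood debit (`0 < s`, `0 ≤ ρ₀`; the deleted other-gross and near-gross terms are each
`≥ −sepFloor s · far`, and other-gross sites are near-gross). -/
theorem farCleanExcessW_sub_le_farExcessW {Q : PeriodicConfiguration 3} (hG : Guard ε s Q) (hs : 0 < s) (hρ : 0 ≤ ρ₀) :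
    farCleanExcessW W ρ₀ Q - sepFloor s * farNearDebitW W ρ₀ Q ≤ farExcessW W Q := by
  have h1 : sepFloor s * (∑ y : Q.motif, if NearOtherGross θ ε R r η L δ L' ρ₀ Q y then W.far Q (y : E3) else 0) ≤
      sepFloor s * farNearDebitW W ρ₀ Q :=
    mul_le_mul_of_nonneg_left (sum_far_nearOtherGross_le_farNearDebitW W ρ₀ Q) (sepFloor_nonneg hs)
  have h2 : farCleanExcessW W ρ₀ Q - sepFloor s * (∑ y : Q.motif, if NearOtherGross θ ε R r η L δ L' ρ₀ Q y then W.far Q (y : E3) else 0)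
      ≤ farExcessW W Q := by
    rw [farCleanExcessW, farExcessW, Finset.mul_sum, ← Finset.sum_sub_distrib]
    refine Finset.sum_le_sum fun y _ => ?_
    have hw := W.far_nonneg Q (y : E3)
    have he := neg_sepFloor_le_siteExcess_of_guard hG hs y
    have hm := mul_le_mul_of_nonneg_left he hw
    by_cases hg : IsOtherGross θ ε R r η L δ L' Q y
    · have hn : NearOtherGross θ ε R r η L δ L' ρ₀ Q y := IsOtherGross.nearOtherGross hρ hg
      rw [if_pos hg, if_pos hn]
      nlinarith
    · by_cases hn : NearOtherGross θ ε R r η L δ L' ρ₀ Q y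
      · rw [if_neg hg, if_pos hn, if_pos hn]
        nlinarith
      · rw [if_neg hg, if_neg hn, if_neg hn]
        simp
  linarith

/-- The reverse one-sided split (far; rattler cap): the far account exceeds the clean far account by at most `max 0 ((ε − e*)/2) ·` the
far neighbourhood debit (`0 ≤ ρ₀`). -/
theorem farExcessW_sub_le_farCleanExcessW {Q : PeriodicConfiguration 3} (hG : Guard ε s Q) (hρ : 0 ≤ ρ₀) :
    farExcessW W Q - max 0 ((ε - eStar) / 2) * farNearDebitW W ρ₀ Q ≤ farCleanExcessW W ρ₀ Q := by
  have hc : 0 ≤ max 0 ((ε - eStar) / 2) := le_max_left _ _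
  have h1 : max 0 ((ε - eStar) / 2) * (∑ y : Q.motif, if NearOtherGross θ ε R r η L δ L' ρ₀ Q y then W.far Q (y : E3) else 0) ≤
      max 0 ((ε - eStar) / 2) * farNearDebitW W ρ₀ Q :=
    mul_le_mul_of_nonneg_left (sum_far_nearOtherGross_le_farNearDebitW W ρ₀ Q) hc
  have h2 : farExcessW W Q - max 0 ((ε - eStar) / 2) *
      (∑ y : Q.motif, if NearOtherGross θ ε R r η L δ L' ρ₀ Q y then W.far Q (y : E3) else 0) ≤ farCleanExcessW W ρ₀ Q := by
    rw [farCleanExcessW, farExcessW, Finset.mul_sum, ← Finset.sum_sub_distrib]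
    refine Finset.sum_le_sum fun y _ => ?_
    have hw := W.far_nonneg Q (y : E3)
    have he := siteExcess_le_cap_of_guard hG y
    have hm := mul_le_mul_of_nonneg_left he hw
    by_cases hg : IsOtherGross θ ε R r η L δ L' Q y
    · have hn : NearOtherGross θ ε R r η L δ L' ρ₀ Q y := IsOtherGross.nearOtherGross hρ hg
      rw [if_pos hg, if_pos hn]
      nlinarith
    · by_cases hn : NearOtherGross θ ε R r η L δ L' ρ₀ Q y
      · rw [if_neg hg, if_pos hn, if_pos hn]
        nlinarith
      · rw [if_neg hg, if_neg hn, if_neg hn]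
        simp
  linarith

end Clean

/-! ## §4 The core-free clean floor (part N-A over `W`) -/

section CoreFree

variable {θ ε R r η L δ L' ϱ : ℝ} (W : CoreWeights θ ε R r η L δ L' ϱ) {ρ₀ s : ℝ}

/-- ★ **THE CORE-FREE CLEAN FAR FLOOR** (`0 ≤ ρ₀`; W2–W4, W8): for a guarded configuration without incoherent cores,
`−max 0 ((ε − e*)/2) · farNearDebitW ≤ farCleanExcessW` — the far account is the whole excess (`≥ 0`) and only the near-gross terms,
together dominated by the debit, are removed. -/
theorem farCleanExcessW_coreFree_ge {Q : PeriodicConfiguration 3} (hG : Guard ε s Q) (hρ : 0 ≤ ρ₀)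
    (h0 : ∀ x : Q.motif, ¬ IsCore θ ε R r η L δ L' Q x) :
    -(max 0 ((ε - eStar) / 2) * farNearDebitW W ρ₀ Q) ≤ farCleanExcessW W ρ₀ Q := by
  have h1 := farExcessW_sub_le_farCleanExcessW W hG hρ
  have h2 := farExcessW_eq_excess_of_forall_not_isCore W h0
  have h3 : 0 ≤ excess Q := excess_nonneg' Q
  linarith

/-- The core-free floor in the shape of the pieces: any slack `c₁`, coefficient `max 0 ((ε − e*)/2)`. -/
theorem farCleanFloorW_of_not_isCore (c₁ : ℝ) {Q : PeriodicConfiguration 3} (hG : Guard ε s Q) (hρ : 0 ≤ ρ₀)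
    (h0 : ∀ x : Q.motif, ¬ IsCore θ ε R r η L δ L' Q x) :
    -(max 0 ((ε - eStar) / 2) * farNearDebitW W ρ₀ Q) - c₁ * (motifCoreIncoherent θ ε R r η L δ L' Q : ℝ) ≤ farCleanExcessW W ρ₀ Q := by
  rw [motifCoreIncoherent_eq_zero_of_not_isCore h0, Nat.cast_zero, mul_zero, sub_zero]
  exact farCleanExcessW_coreFree_ge W hG hρ h0

end CoreFree

end Summit.AtomisticToContinuum.Crystallization.Theorems.ChargedEnergyGapChartDial

end

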